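import Mathlib
import Literature.AlgebraicGeometry.Resolution.CobordantGame
import Summits.ResolutionOfSingularities.ResolutionOfSingularities.Theorems.WeightedInvariantLocalWeightedDropTwistedCylinder

/-!
# `WeightedInvariant.LocalWeightedDrop`: the ORDER-DROP test for origin-fixing twisted triviality

Route `ResolutionOfSingularities/WeightedInvariant`, crux `LocalWeightedDrop`
(stmt-ResolutionOfSingularities-8899).  [OURS · L1 W4.3] — a usable NEGATIVE criterion for the repaired
predicate `GradedGame.TwistedTrivialAlongFix` (landed in `…TwistedCylinder`), requested by res-L1-w43-tri-1's
TRIAGE v4 §13.1 for the re-run of card A's I-saturation proxy `satSet` on its witnesses («`satSet` must come out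
a PROPER subset»).  Nothing here is a statement of the manuscript under review on ladder RESOLUTION;
AI-produced, weaker than expert review.

**Criterion** (`GradedGame.not_twistedTrivialAlongFix_of_offAxisDegree_lt`).  Let `f ∈ k⟦x₁..xₙ⟧` lie in
`𝔪^M` (every monomial of `f` has total degree `≥ M`) and let `f` contain a monomial `x^m` whose degree OFF the
`i`-th axis is `< M` (`|m| − mᵢ < M`).  Then, for `p ≠ 0`, `f` is NOT twisted-trivial along the `xᵢ`-axis in the
origin-fixing sense.  (Special case `M = 2`, `|m| − mᵢ ≤ 1` for singular germs:
`GradedGame.not_twistedTrivialAlongFix_of_isSingular`; the toy case `x²` of `…TwistedTrivialSanity` is `M = 2`,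
`m = 2eᵢ`.)

**Proof.**  Give `σ` weight `0` and every `x`-variable weight `1` (`xWeight`).  An origin-fixing `Φ` has all its
components of weighted order `≥ 1`, so `u · f(Φ)` has weighted order `≥ M` and its coefficient at the monomial
`μ* = σ^{p^e mᵢ} · x^{m − mᵢ eᵢ}` (weight `|m| − mᵢ < M`) vanishes.  On the other side the coefficient of `μ*` in
`f(x + σ^{p^e} eᵢ)` is `f_m ≠ 0`: killing `xᵢ` does not change `μ*`-coefficients (`coeff_subst_keep`) and turns
the translation into the monomial substitution `xᵢ ↦ σ^{p^e}`, `xⱼ ↦ xⱼ`, which is injective on exponents.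
-/

set_option linter.dupNamespace false -- mandated namespace of this single-conjunct summit
set_option autoImplicit false

namespace Summit.ResolutionOfSingularities.ResolutionOfSingularities.Theorems

namespace GradedGame

open MvPowerSeries
open Literature.AlgebraicGeometry.Resolution

variable {k : Type} [Field k]

/-! ## Keep/kill substitutions and their coefficients -/

/-- The substitution keeping the variables in `P` and killing the others is substitutable. [OURS · L1 W4.3] -/
theorem hasSubst_keep {N : ℕ} (P : Fin N → Prop) [DecidablePred P] :
    HasSubst (fun v : Fin N => if P v then (X v : MvPowerSeries (Fin N) k) else 0) :=
  hasSubst_of_constantCoeff_zero fun v => by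
    by_cases h : P v <;> simp [h, constantCoeff_X]

/-- The monomial `x^α` under keep/kill: itself if `α` lives on the kept variables, else `0`. [OURS · L1 W4.3] -/
theorem prod_pow_keep_eq {N : ℕ} (P : Fin N → Prop) [DecidablePred P] (α : Fin N →₀ ℕ) :
    (α.prod fun v e => (if P v then (X v : MvPowerSeries (Fin N) k) else 0) ^ e) =
      if ∀ v ∈ α.support, P v then monomial α 1 else 0 := by
  classical
  split_ifs with h
  · rw [Finsupp.prod_congr (g2 := fun v e => monomial (Finsupp.single v e) (1 : k))
      (fun v hv => by rw [if_pos (h v hv), X_pow_eq])]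
    unfold Finsupp.prod
    rw [prod_monomial, Finset.prod_const_one]
    exact congrArg (fun β => monomial β (1 : k)) (Finsupp.sum_single α)
  · push Not at h
    obtain ⟨v, hv, hPv⟩ := h
    exact Finset.prod_eq_zero hv (by simp only [if_neg hPv]; exact zero_pow (Finsupp.mem_support_iff.mp hv))

/-- Keep/kill does not change the coefficients of monomials living on the kept variables. [OURS · L1 W4.3] -/
theorem coeff_subst_keep {N : ℕ} (P : Fin N → Prop) [DecidablePred P] (ψ : MvPowerSeries (Fin N) k)
    (μ : Fin N →₀ ℕ) (hμ : ∀ v, μ v ≠ 0 → P v) :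
    coeff μ (subst (fun v : Fin N => if P v then (X v : MvPowerSeries (Fin N) k) else 0) ψ) = coeff μ ψ := by
  classical
  rw [coeff_subst (hasSubst_keep P), finsum_eq_single _ μ]
  · rw [prod_pow_keep_eq, if_pos (fun v hv => hμ v (Finsupp.mem_support_iff.mp hv)), coeff_monomial_same,
      smul_eq_mul, mul_one]
  · intro α hα
    rw [prod_pow_keep_eq]
    split_ifs
    · rw [coeff_monomial_ne (Ne.symm hα), smul_zero]
    · rw [map_zero, smul_zero]

/-! ## The `x`-weight and the weighted order of an origin-fixing substitution -/

/-- Weight `0` on `σ = X 0`, weight `1` on the shifted `x`-variables. [OURS · L1 W4.3] -/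
def xWeight (n : ℕ) : Fin (n + 1) → ℕ := fun v => if v = 0 then 0 else 1

/-- ORIGIN-FIXING ⇒ every component has `x`-weighted order `≥ 1`: a series killed by `x ↦ 0` has no pure-`σ`
monomial. [OURS · L1 W4.3] -/
theorem one_le_weight_of_fix {n : ℕ} (ψ : MvPowerSeries (Fin (n + 1)) k)
    (hfix : subst (fun v : Fin (n + 1) => if v = 0 then (X (0 : Fin (n + 1)) : MvPowerSeries (Fin (n + 1)) k) else 0)
      ψ = 0)
    (d : Fin (n + 1) →₀ ℕ) (hd : coeff d ψ ≠ 0) : 1 ≤ Finsupp.weight (xWeight n) d := by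
  classical
  by_contra hlt
  push Not at hlt
  have h0 : ∀ v, d v ≠ 0 → v = 0 := by
    intro v hv
    by_contra hv0
    have : Finsupp.weight (xWeight n) d ≠ 0 := by
      rw [Finsupp.weight_apply, Finsupp.sum]
      refine Nat.pos_iff_ne_zero.mp (lt_of_lt_of_le ?_ (Finset.single_le_sum (fun j _ => Nat.zero_le _)
        (Finsupp.mem_support_iff.mpr hv)))
      simp [xWeight, hv0, Nat.pos_iff_ne_zero.mpr hv]
    omega
  have hK : (fun v : Fin (n + 1) => if v = 0 then (X (0 : Fin (n + 1)) : MvPowerSeries (Fin (n + 1)) k) else 0) =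
      (fun v : Fin (n + 1) => if v = 0 then (X v : MvPowerSeries (Fin (n + 1)) k) else 0) := by
    funext v
    by_cases hv : v = 0
    · subst hv; simp
    · simp [hv]
  rw [hK] at hfix
  have := coeff_subst_keep (fun v : Fin (n + 1) => v = 0) ψ d h0
  rw [hfix, map_zero] at this
  exact hd this.symm

/-- An ORIGIN-FIXING substitution raises the `x`-weighted order to at least the `𝔪`-adic order of the argument:
if every component of `Φ` has no pure-`σ` monomial and `f ∈ 𝔪^M`, then `wt-ord (f(Φ)) ≥ M`. [OURS · L1 W4.3] -/
theorem le_weightedOrder_subst_of_fix {n : ℕ} {Φ : Fin n → MvPowerSeries (Fin (n + 1)) k} (hΦ : HasSubst Φ)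
    (hfixw : ∀ j, ∀ d, coeff d (Φ j) ≠ 0 → 1 ≤ Finsupp.weight (xWeight n) d)
    (f : MvPowerSeries (Fin n) k) (M : ℕ) (hM : ∀ d, coeff d f ≠ 0 → M ≤ d.degree) :
    (M : ℕ∞) ≤ weightedOrder (xWeight n) (subst Φ f) := by
  classical
  have hΦ1 : ∀ j, (1 : ℕ∞) ≤ weightedOrder (xWeight n) (Φ j) := fun j =>
    le_weightedOrder _ fun d hd => by
      by_contra hne
      have h1 := hfixw j d hne
      have : Finsupp.weight (xWeight n) d < 1 := by exact_mod_cast hd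
      omega
  apply le_weightedOrder
  intro μ hμ
  rw [coeff_subst hΦ]
  apply finsum_eq_zero_of_forall_eq_zero
  intro d
  by_cases hd : coeff d f = 0
  · rw [hd, zero_smul]
  have hMd := hM d hd
  suffices h0 : coeff μ (d.prod fun j e => Φ j ^ e) = 0 by rw [h0, smul_zero]
  apply coeff_eq_zero_of_lt_weightedOrder
  refine lt_of_lt_of_le hμ ?_
  calc (M : ℕ∞) ≤ (d.degree : ℕ) := by exact_mod_cast hMd
    _ = ∑ j ∈ d.support, ((d j : ℕ) : ℕ∞) := by rw [Finsupp.degree_apply, Nat.cast_sum]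
    _ ≤ ∑ j ∈ d.support, d j • weightedOrder (xWeight n) (Φ j) :=
        Finset.sum_le_sum fun j _ => by
          calc ((d j : ℕ) : ℕ∞) = d j • (1 : ℕ∞) := by rw [nsmul_one]
            _ ≤ d j • weightedOrder (xWeight n) (Φ j) := nsmul_le_nsmul_right (hΦ1 j) _
    _ ≤ ∑ j ∈ d.support, weightedOrder (xWeight n) (Φ j ^ d j) :=
        Finset.sum_le_sum fun j _ => le_weightedOrder_pow _ _
    _ ≤ weightedOrder (xWeight n) (∏ j ∈ d.support, Φ j ^ d j) := le_weightedOrder_prod _ _ _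

/-! ## The monomial substitution `xᵢ ↦ σ^q`, `xⱼ ↦ xⱼ` -/

section MonoSubst

variable {n : ℕ} (i : Fin n) (q : ℕ)

/-- Exponent of the image of `xⱼ` under `xᵢ ↦ σ^q`, `xⱼ ↦ xⱼ` (shifted). [OURS · L1 W4.3] -/
noncomputable def nuExp (j : Fin n) : Fin (n + 1) →₀ ℕ :=
  if j = i then Finsupp.single 0 q else Finsupp.single j.succ 1

/-- Exponent of the image of `x^d`. [OURS · L1 W4.3] -/
noncomputable def thetaExp (d : Fin n →₀ ℕ) : Fin (n + 1) →₀ ℕ :=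
  d.sum fun j e => e • nuExp i q j

/-- Components of the image exponent. [OURS · L1 W4.3] -/
theorem thetaExp_apply (d : Fin n →₀ ℕ) (v : Fin (n + 1)) :
    thetaExp i q d v = d.sum fun j e => e * nuExp i q j v := by
  unfold thetaExp
  rw [Finsupp.sum_apply]
  exact Finsupp.sum_congr fun j _ => by simp

/-- The `σ`-component of the image exponent is `q·dᵢ`. [OURS · L1 W4.3] -/
theorem thetaExp_apply_zero (d : Fin n →₀ ℕ) : thetaExp i q d 0 = d i * q := by
  classical
  rw [thetaExp_apply, Finsupp.sum]
  have : ∀ j ∈ d.support, d j * nuExp i q j 0 = if j = i then d j * q else 0 := by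
    intro j _
    unfold nuExp
    by_cases hj : j = i
    · subst hj; simp
    · simp [hj, (Fin.succ_ne_zero j)]
  rw [Finset.sum_congr rfl this, Finset.sum_ite_eq']
  split_ifs with hi
  · rfl
  · rw [Finsupp.notMem_support_iff.mp hi, zero_mul]

/-- The `xₗ`-component (`l ≠ i`) of the image exponent is `dₗ`. [OURS · L1 W4.3] -/
theorem thetaExp_apply_succ (d : Fin n →₀ ℕ) (l : Fin n) (hl : l ≠ i) : thetaExp i q d l.succ = d l := by
  classical
  rw [thetaExp_apply, Finsupp.sum]
  have : ∀ j ∈ d.support, d j * nuExp i q j l.succ = if j = l then d j else 0 := by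
    intro j _
    unfold nuExp
    by_cases hj : j = i
    · subst hj
      rw [if_pos rfl, if_neg (Ne.symm hl)]
      simp
    · rw [if_neg hj]
      by_cases hjl : j = l
      · subst hjl; simp
      · rw [if_neg hjl]
        simp [hjl]
  rw [Finset.sum_congr rfl this, Finset.sum_ite_eq']
  split_ifs with hi
  · rfl
  · exact (Finsupp.notMem_support_iff.mp hi).symm

/-- The `xᵢ`-component of the image exponent vanishes. [OURS · L1 W4.3] -/
theorem thetaExp_apply_self_succ (d : Fin n →₀ ℕ) : thetaExp i q d i.succ = 0 := by
  classical
  rw [thetaExp_apply, Finsupp.sum]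
  refine Finset.sum_eq_zero fun j _ => ?_
  unfold nuExp
  by_cases hj : j = i
  · subst hj; simp
  · rw [if_neg hj]
    simp [hj]

/-- `x^d ↦ σ^{q dᵢ} x^{d − dᵢeᵢ}` is injective on exponents for `q ≠ 0`. [OURS · L1 W4.3] -/
theorem thetaExp_injective (hq : q ≠ 0) : Function.Injective (thetaExp i q) := by
  intro d d' h
  ext l
  by_cases hl : l = i
  · subst hl
    have := congrArg (fun θ => θ 0) h
    simp only [thetaExp_apply_zero] at this
    exact Nat.eq_of_mul_eq_mul_right (Nat.pos_of_ne_zero hq) this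
  · have := congrArg (fun θ => θ l.succ) h
    simpa only [thetaExp_apply_succ i q _ l hl] using this

/-- The image of the monomial `x^d`. [OURS · L1 W4.3] -/
theorem prod_pow_monomial_nuExp (d : Fin n →₀ ℕ) :
    (d.prod fun j e => (monomial (nuExp i q j) (1 : k)) ^ e) = monomial (thetaExp i q d) 1 := by
  unfold Finsupp.prod thetaExp
  simp_rw [monomial_pow, one_pow]
  rw [prod_monomial, Finset.prod_const_one]
  rfl

/-- `x`-weight of the image exponent: `|m| − mᵢ`. [OURS · L1 W4.3] -/
theorem weight_thetaExp_add (m : Fin n →₀ ℕ) : Finsupp.weight (xWeight n) (thetaExp i q m) + m i = m.degree := by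
  classical
  unfold thetaExp
  rw [map_finsuppSum, Finsupp.degree_apply, Finsupp.sum]
  have hν : ∀ j ∈ m.support, Finsupp.weight (xWeight n) (m j • nuExp i q j) = if j = i then 0 else m j := by
    intro j _
    rw [map_nsmul]
    unfold nuExp
    by_cases hj : j = i
    · subst hj; simp [Finsupp.weight_single, xWeight]
    · simp [hj, Finsupp.weight_single, xWeight, Fin.succ_ne_zero]
  rw [Finset.sum_congr rfl hν]
  have hsplit : ∀ j ∈ m.support, m j = (if j = i then 0 else m j) + (if j = i then m j else 0) := by
    intro j _
    by_cases hj : j = i <;> simp [hj]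
  rw [Finset.sum_congr rfl hsplit, Finset.sum_add_distrib, Finset.sum_ite_eq']
  split_ifs with hi
  · rfl
  · rw [Finsupp.notMem_support_iff.mp hi]

end MonoSubst

/-! ## The criterion -/

/-- ORDER-DROP TEST.  If `f ∈ 𝔪^M` has a monomial `x^m` with `|m| − mᵢ < M`, then `f` is NOT twisted-trivial along
the `xᵢ`-axis in the origin-fixing sense (`p ≠ 0`). [OURS · L1 W4.3] -/
theorem not_twistedTrivialAlongFix_of_offAxisDegree_lt (p : ℕ) (hp : p ≠ 0) {n : ℕ} (f : MvPowerSeries (Fin n) k)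
    (i : Fin n) (M : ℕ) (hM : ∀ d, coeff d f ≠ 0 → M ≤ d.degree) (m : Fin n →₀ ℕ) (hm : coeff m f ≠ 0)
    (hlt : m.degree < M + m i) : ¬ TwistedTrivialAlongFix p f (axisCurve i) := by
  classical
  rintro ⟨-, e, Φ, u, -, hΦ0, hfix, -, heq⟩
  have hq : p ^ e ≠ 0 := pow_ne_zero e hp
  have hΦs : HasSubst Φ := hasSubst_of_constantCoeff_zero hΦ0
  have hfixw : ∀ j, ∀ d, coeff d (Φ j) ≠ 0 → 1 ≤ Finsupp.weight (xWeight n) d :=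
    fun j d hd => one_le_weight_of_fix (Φ j) (hfix j) d hd
  -- the test monomial `μ* = σ^{p^e mᵢ} x^{m − mᵢ eᵢ}` is `thetaExp i (p ^ e) m`
  have hwt : Finsupp.weight (xWeight n) (thetaExp i (p ^ e) m) < M := by
    have := weight_thetaExp_add i (p ^ e) m
    omega
  -- RHS: the coefficient of `μ*` in `u · f(Φ)` vanishes by weighted order
  have hR : coeff (thetaExp i (p ^ e) m) (u * subst Φ f) = 0 := by
    apply coeff_eq_zero_of_lt_weightedOrder
    calc ((Finsupp.weight (xWeight n) (thetaExp i (p ^ e) m) : ℕ) : ℕ∞) < (M : ℕ) := by exact_mod_cast hwt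
      _ ≤ weightedOrder (xWeight n) (subst Φ f) := le_weightedOrder_subst_of_fix hΦs hfixw f M hM
      _ ≤ weightedOrder (xWeight n) u + weightedOrder (xWeight n) (subst Φ f) := le_add_self
      _ ≤ weightedOrder (xWeight n) (u * subst Φ f) := le_weightedOrder_mul _
  -- LHS: the translation family, and its coefficient at `μ*`
  set a : Fin 1 → MvPowerSeries (Fin (n + 1)) k := fun _ => (X (0 : Fin (n + 1)) : MvPowerSeries (Fin (n + 1)) k) ^ (p ^ e)
    with ha_def
  have ha : HasSubst a := hasSubst_of_constantCoeff_zero fun _ => by simp [a, constantCoeff_X, zero_pow hq]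
  set T : Fin n → MvPowerSeries (Fin (n + 1)) k := fun j => X j.succ + subst a (axisCurve (k := k) i j) with hT
  have hTj : ∀ j, T j = X j.succ + if j = i then X 0 ^ (p ^ e) else 0 := by
    intro j
    simp only [hT, axisCurve]
    by_cases hj : j = i
    · rw [if_pos hj, if_pos hj, subst_X ha]
    · rw [if_neg hj, if_neg hj, ← coe_substAlgHom ha, map_zero]
  have hTs : HasSubst T := hasSubst_of_constantCoeff_zero fun j => by
    rw [hTj]
    by_cases hj : j = i
    · simp [hj, constantCoeff_X, zero_pow hq]
    · simp [hj, constantCoeff_X]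
  -- kill `xᵢ`: keep the variables `≠ i.succ`
  have hKs := hasSubst_keep (k := k) (fun v : Fin (n + 1) => v ≠ i.succ)
  have hS : ∀ j, subst (fun v : Fin (n + 1) => if v ≠ i.succ then (X v : MvPowerSeries (Fin (n + 1)) k) else 0) (T j) =
      monomial (nuExp i (p ^ e) j) 1 := by
    intro j
    rw [hTj, subst_add hKs, subst_X hKs]
    unfold nuExp
    by_cases hj : j = i
    · subst hj
      rw [if_pos rfl, if_pos rfl, subst_pow hKs, subst_X hKs, if_neg (not_not.mpr rfl),
        if_pos (Fin.succ_ne_zero j).symm, zero_add, X_pow_eq]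
    · rw [if_neg hj, if_neg hj, if_pos (fun h => hj (Fin.succ_injective _ h)), ← coe_substAlgHom hKs, map_zero,
        add_zero, X_def]
  have hSs : HasSubst (fun j : Fin n => (monomial (nuExp i (p ^ e) j) (1 : k) : MvPowerSeries (Fin (n + 1)) k)) := by
    have : (fun j : Fin n => (monomial (nuExp i (p ^ e) j) (1 : k) : MvPowerSeries (Fin (n + 1)) k)) =
        fun j => subst (fun v : Fin (n + 1) => if v ≠ i.succ then (X v : MvPowerSeries (Fin (n + 1)) k) else 0) (T j) :=
      funext fun j => (hS j).symm
    rw [this]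
    have h := hTs.comp hKs
    simp only [coe_substAlgHom] at h
    exact h
  have hL : coeff (thetaExp i (p ^ e) m) (subst T f) = coeff m f := by
    have hμi : ∀ v, thetaExp i (p ^ e) m v ≠ 0 → v ≠ i.succ := by
      intro v hv hvi
      subst hvi
      exact hv (thetaExp_apply_self_succ i (p ^ e) m)
    rw [← coeff_subst_keep (fun v : Fin (n + 1) => v ≠ i.succ) (subst T f) _ hμi, subst_comp_subst_apply hTs hKs]
    rw [show (fun j => subst (fun v : Fin (n + 1) => if v ≠ i.succ then (X v : MvPowerSeries (Fin (n + 1)) k) else 0)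
        (T j)) = fun j => (monomial (nuExp i (p ^ e) j) (1 : k) : MvPowerSeries (Fin (n + 1)) k) from funext hS]
    rw [coeff_subst hSs, finsum_eq_single _ m]
    · rw [prod_pow_monomial_nuExp, coeff_monomial_same, smul_eq_mul, mul_one]
    · intro d hd
      rw [prod_pow_monomial_nuExp, coeff_monomial_ne, smul_zero]
      exact fun h => hd (thetaExp_injective i (p ^ e) hq h).symm
  -- compare
  have := congrArg (coeff (thetaExp i (p ^ e) m)) heq
  rw [hL, hR] at this
  exact hm this

/-- Singular germs lie in `𝔪²`. [OURS · L1 W4.3] -/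
theorem two_le_degree_of_isSingular {n : ℕ} {f : MvPowerSeries (Fin n) k} (hf : CobordantGame.IsSingular k f)
    (d : Fin n →₀ ℕ) (hd : coeff d f ≠ 0) : 2 ≤ d.degree := by
  classical
  obtain ⟨-, h0, h1⟩ := hf
  by_contra hlt
  push Not at hlt
  have hdeg : d.degree = 0 ∨ d.degree = 1 := by omega
  rcases hdeg with h | h
  · rw [Finsupp.degree_eq_zero_iff] at h
    subst h
    exact hd (by rw [coeff_zero_eq_constantCoeff]; exact h0)
  · -- `d = single j 1`
    have hne : d ≠ 0 := by rintro rfl; simp at h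
    obtain ⟨j, hj⟩ : ∃ j, d j ≠ 0 := by
      by_contra! hc
      exact hne (Finsupp.ext hc)
    have hle : d j ≤ d.degree := Finsupp.le_degree j d
    have hdj : d j = 1 := by omega
    have hd' : d = Finsupp.single j 1 := by
      ext l
      by_cases hl : l = j
      · subst hl; simp [hdj]
      · rw [Finsupp.single_apply, if_neg (Ne.symm hl)]
        have hsum : d.degree = d j + (d - Finsupp.single j (d j)).degree := by
          conv_lhs => rw [← add_tsub_cancel_of_le (Finsupp.single_le_iff.mpr (le_refl (d j)) :
            Finsupp.single j (d j) ≤ d)]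
          rw [map_add, Finsupp.degree_single]
        have h0' : (d - Finsupp.single j (d j)).degree = 0 := by omega
        rw [Finsupp.degree_eq_zero_iff] at h0'
        have := DFunLike.congr_fun h0' l
        simp [Ne.symm hl] at this
        exact this
    exact hd (by rw [hd']; exact h1 j)

/-- ORDER-DROP TEST FOR SINGULAR GERMS: a monomial `x^m` of `f` with at most ONE factor off the `xᵢ`-axis
(`|m| ≤ mᵢ + 1`, e.g. `xᵢ^a` or `xᵢ^a xⱼ`) rules out origin-fixing twisted triviality along `xᵢ`. [OURS · L1 W4.3] -/
theorem not_twistedTrivialAlongFix_of_isSingular (p : ℕ) (hp : p ≠ 0) {n : ℕ} (f : MvPowerSeries (Fin n) k)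
    (hf : CobordantGame.IsSingular k f) (i : Fin n) (m : Fin n →₀ ℕ) (hm : coeff m f ≠ 0)
    (hlt : m.degree ≤ m i + 1) : ¬ TwistedTrivialAlongFix p f (axisCurve i) :=
  not_twistedTrivialAlongFix_of_offAxisDegree_lt p hp f i 2 (two_le_degree_of_isSingular hf) m hm (by omega)

end GradedGame

end Summit.ResolutionOfSingularities.ResolutionOfSingularities.Theorems
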